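import Literature.NumberTheory.GaloisRepresentations.DrigArtinian
import Literature.NumberTheory.GaloisRepresentations.DrigArtinianFunctor
import Literature.NumberTheory.GaloisRepresentations.BergerDstOnPhiGamma
import HarnessLib

/-!
# The pinned `(φ, Γ)`-package of the Steinberg weight-velocity mechanism; infinitesimal gap velocity

Requested notion `SteinbergVelocityPackage` (item `defn-SteinbergVelocityPackage`; route `Langlands/SteinbergWeightVelocity`,
generation 3).  Two kinds of declarations, all PREDICATES / plain definitions, nothing asserted:

* **Pins and printed theorems as predicates on the data** `𝔇 : PhiGammaModuleData p F E` /
  `𝓣 : PhiGammaModuleRobba p F E` / `𝓣 : PhiGammaModuleRobbaLog p F E`, `𝓐 : 𝓣.DrigArtinian`, `𝓒 : 𝓣.RelativeCharData`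
  (in the style of `IsKPX`, `HasDingCrystallineCriterion`, `DrigArtinian.IsFunctorial`):
  - `PhiGammaModuleData.HasTensorCompatibleDrig` — `D_rig(V₁ ⊗ V₂) ≅ D_rig(V₁) ⊗ D_rig(V₂)` (Kronecker matrices in the
    product frame) [cite: KedlayaPottharstXiao2014, Thm. 2.2.17], [cite: BellaicheChenevier2009, Prop. 2.2.6 (i) (arXiv:math/0602340 numbering)].
    This is the PIN of the package: the axioms of `PhiGammaModuleData` / `IsKPX` are invariant under re-indexing `Drig` by any
    bijection of isomorphism classes fixing the trivial class (refuter-cdisprove on stmt-Langlands-13450: `twistSwap`, `dual`,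
    `swap`), whereas a `⊗`-compatible such bijection is Tannakian (an automorphism of `Γ_F`, duality, or a conjugation of
    coefficients).
  - `PhiGammaModuleRobba.HasPerfectSpecialPairing` — for a special consecutive ratio (`dim_E H² = 1`) and a non-split graded
    class `c_i`, some `θ ∈ Hom(Fˣ, E)` has class outside `𝓛 = c_i^⊥` (the cup product `H¹(𝓡(δ)) × H¹(𝓡) → H²(𝓡(δ)) ≅ E` is
    perfect, so `c_i^⊥` is a hyperplane) [cite: Ding2019SimpleL, §3.1].
  - `gapDerivative δ̃ᵢ δ̃ⱼ` — the additive character `ψ` with `δ̃ᵢδ̃ⱼ⁻¹ = δᵢδⱼ⁻¹(1 + εψ)`, i.e. `snd/fst` of the ratio in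
    `E[ε] = DualNumber E` [cite: Ding2019SimpleL, Thm. 3.4].
  - `PhiGammaModuleRobba.RelativeCharData.HasColmezGreenbergStevens` — the first-order Colmez–Greenberg–Stevens formula: for a
    non-critical special triangular `D` and a deformation `D̃ ∈ 𝓣.deformationsOver E[ε]` of `D` triangular with relative rank-one
    parameters `𝓡_{E[ε]}(δ̃ⱼ)` lifting `δⱼ`, the gap derivative `ψᵢ` has class in `𝓛(D)_i = c_i^⊥`
    [cite: Ding2019SimpleL, Thm. 3.4], [cite: Colmez2010Linvariants, Thm. 0.5].
  - `PhiGammaModuleRobbaLog.HasDingSteinbergDictionary f` — Ding's §3.1 criterion and Lemma 3.2 in the form the route consumes: a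
    semistable framed `D` with a strict triangulation whose consecutive ratios are special and whose graded classes are non-split,
    such that NO non-zero locally constant (= unramified) additive character has class in any `𝓛(D)_i`, has `N^{n-1} ≠ 0` on
    Berger's `D_st(D)` [cite: Ding2019SimpleL, §3.1 and Lemma 3.2], [cite: BergerLaurent2002, Thm. 0.2].
  - `PhiGammaModuleRobbaLog.IsSteinbergVelocityPackage 𝓣 𝓐 𝓒 d f` — the conjunction
    `IsKPX d ∧ HasTensorCompatibleDrig ∧ 𝓐.IsFunctorial ∧ 𝓐.HasBCEquivalence ∧ 𝓐.HasRestrictionCompatibility ∧ 𝓒.IsCompatible ∧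
    HasPerfectSpecialPairing ∧ 𝓒.HasColmezGreenbergStevens ∧ HasDingSteinbergDictionary f`.
  - `DrigArtinian.HasRestrictionCompatibility` — `D_rig` of the restriction of scalars `Res_{E[ε]/E} ρ_ε` is the restriction of
    scalars of `DrigOver E[ε] ρ_ε` (block matrices `[[A,0],[B,A]]` ↦ `[[P₀,0],[P₁,P₀]]`): the second pin, which ties `DrigOver` on
    first-order deformations to `Drig` (an automorphism of the deformation functor compatible with it is a scalar on `Ext¹` when
    `End = E`) [cite: BellaicheChenevier2009, §2.2.1 and Lemma 2.2.7 (arXiv:math/0602340 numbering)].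
* **Infinitesimal gap velocity** (global): `FramedGaloisRep.HasInfinitesimalGapVelocityAt v 𝓐 𝓒 rK δ i hi` — every continuous
  additive `φ : K_vˣ → E₀` agrees ON THE UNITS with an `E₀`-combination of gap derivatives `ψᵢ(δ̃)` of GLOBAL first-order
  deformations `ρ̃ : Γ_K →ₜ* GL_n(E₀[ε])` of `rK` whose `D_rig` at `v` (`𝓐.drigOverDualNumber`) is upper-triangular with relative
  rank-one parameters `𝓒.ofCharOver E₀[ε] (δ̃ⱼ)` lifting `δⱼ` ("full weight velocity of the global tangent directions at the pair
  `(i, i+1)`"; the tangent space of the eigenvariety is the intended source [cite: HansenUniversalEigenvarieties2017, Thm. 1.1.6],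
  [cite: BarreraGrahamWilliams2026, Rem. 1.3–1.4]).

Nothing here is a theorem; the genuine `(φ, Γ)`-module theory satisfies every predicate of the first kind (see the cited sources),
and the second is the route's crux.

## Mathlib / Literature declarations used

`PhiGammaModuleData(.Drig, .ring)`, `FramedPhiGammaModule(.conj, .matPhi, .matGamma, .IsTriangularWith, .toPhiGammaModule)`,
`PhiGammaModuleRobba(.IsKPX, .IsCyclotomic, .H2, .H1toH1, .homToH1, .gen, .ofChar, .R, .deformationsOver, .RelativeCharData,
.DrigArtinian)`, `DrigArtinian(.IsFunctorial, .HasBCEquivalence, .drigOverDualNumber)`, `RelativeCharData(.ofCharOver, .IsCompatible)`,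
`PhiGammaModule(.unit, .IsContinuous, .Triangulation(.ratioParam, .gradedClass, .IsNonSplitAt, .IsStrict, .ofTriangular))`,
`RankOneDatum.toModule(.cupOrthogonal)`, `PhiGammaModuleRobbaLog(.IsSemistable, .nDst)`, `HomCont`, `FramedGaloisRep(.toLocal)`,
`moduleFinite_dualNumber`.  Mathlib: `DualNumber`, `TrivSqZeroExt.fst/snd/fstHom`, `Matrix.kroneckerMap`, `Matrix.reindex`,
`finProdFinEquiv`, `IsLocallyConstant`, `Valued.v`.

## Second revision (item `defn-SteinbergVelocityPackage`, literature-prover): the rank guard and proved API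

* `HasDingSteinbergDictionary` now quantifies over ranks `m ≥ 2` (Ding's `Δ = {1, …, n-1}` is non-empty; the route has
  `2 ≤ n`).  As first landed (p71301) the clause ranged over ALL `m`, and at `m = 0` every hypothesis holds for the rank-zero
  framed module while the conclusion `N^{0-1} = N^0 = 1 ≠ 0` fails on the zero space `D_st(0)`: the predicate — hence
  `IsSteinbergVelocityPackage` and the alias `SteinbergVelocityPackage` — was UNSATISFIABLE for every datum, which would have made
  every route item positing the package vacuous (machine-checked refutation attached as evidence `Vacuity.lean` on the item).
  No other statement is changed.
* Proved API (all `[folklore]` algebra unless cited): `fst_units_ne_zero`; `gapDerivative_apply`, `gapDerivative_self`,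
  **`gapDerivative_mul`** (the gap derivative is additive — it IS an additive character), `ratio_eq_inl_fst_mul` (the defining
  identity `δ̃ᵢδ̃ⱼ⁻¹ = a(1 + εψ)` of [cite: Ding2019SimpleL, Thm. 3.4]); the bridge
  `PhiGammaModuleData.hasTensorCompatibleDrig_iff` between the matrix form of the pin and the framed-tensor form
  `D_rig(ρ ⊗ ρ') ≅ D_rig(ρ) ⊗ D_rig(ρ')` (`FramedRep.tensor`, `FramedPhiGammaModule.tensor` of `DrigArtinianFunctor.lean`, whose
  `DrigArtinian.IsTensorial` is the same property over finite local `E`-algebras); `HasPerfectSpecialPairing.cupOrthogonal_ne_top`;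
  the projections `IsSteinbergVelocityPackage.isKPX`, …, `.hasDingSteinbergDictionary`; and
  `FramedGaloisRep.fst_apply_eq_iff_mem_deformationsOver` (the entrywise "`fst ∘ ρ̃ = rK`" of `HasInfinitesimalGapVelocityAt` is
  membership in `FramedGaloisRep.deformationsOver (DualNumber E₀) fstHom rK`).
* Sources re-read for this revision: [cite: Ding2019SimpleL, §3.1, Lemma 3.2, Thm. 3.4, Prop. 3.6] (arXiv:1807.10862, chunks
  24–27: "We call `(D, {δ_i})` non-critical special if `D_i^{i+1}` is non-split and `δ_iδ_{i+1}⁻¹` is special for all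
  `i ∈ Δ = {1, ⋯, n-1}`"; "We have `N^{n-1} ≠ 0` on `D_st(D)` if and only if `D_i^{i+1}` is semi-stable non-crystalline for all
  `i ∈ Δ`"); [cite: KedlayaPottharstXiao2014, Thm. 2.3.11 (Liu) (3)] (arXiv:1203.5718, chunk 18: "The duality cup product is a
  perfect pairing"); [cite: HansenUniversalEigenvarieties2017, Thm. 1.1.6] (arXiv:1412.1533, chunk 7).
-/

noncomputable section

namespace Literature.NumberTheory.GaloisRepresentations

open scoped TensorProduct NumberField
open IsDedekindDomain

universe u v w

/-! ## Part 1. Pins and printed theorems as predicates on the data -/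

section Pins

variable {p : ℕ} [Fact p.Prime] {F : Type u} [Field F] [TopologicalSpace F]
  {E : Type v} [Field E] [TopologicalSpace E] [IsTopologicalRing E]

/-- **`D_rig` is `⊗`-compatible**: if `r = r₁ ⊗ r₂` as framed representations (Kronecker matrices in the product frame
ordered by `finProdFinEquiv`), then `D_rig(r)` is, in some basis `U`, the Kronecker product of `D_rig(r₁)` and `D_rig(r₂)`
(matrices of `φ` and of every `σ`).  For the genuine rule this is the `⊗`-functoriality of Berger's `D_rig^†`
(`(B_rig^† ⊗ (V₁ ⊗ V₂))^{H_F} ⊇ D_rig(V₁) ⊗ D_rig(V₂)`, an isomorphism by étale descent).  A predicate ON the datum, nothing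
asserted.  [cite: KedlayaPottharstXiao2014, Thm. 2.2.17] -/
def PhiGammaModuleData.HasTensorCompatibleDrig (𝔇 : PhiGammaModuleData.{u, v, w} p F E) : Prop :=
  ∀ (a b : ℕ) (r₁ : FramedGaloisRep F E a) (r₂ : FramedGaloisRep F E b) (r : FramedGaloisRep F E (a * b)),
    (∀ σ : Field.absoluteGaloisGroup F,
      ((r σ : Matrix.GeneralLinearGroup (Fin (a * b)) E) : Matrix (Fin (a * b)) (Fin (a * b)) E) =
        Matrix.reindex finProdFinEquiv finProdFinEquiv
          (Matrix.kroneckerMap (fun x y => x * y)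
            ((r₁ σ : Matrix.GeneralLinearGroup (Fin a) E) : Matrix (Fin a) (Fin a) E)
            ((r₂ σ : Matrix.GeneralLinearGroup (Fin b) E) : Matrix (Fin b) (Fin b) E))) →
    ∃ U : Matrix.GeneralLinearGroup (Fin (a * b)) 𝔇.ring.R,
      ((((𝔇.Drig r).conj U).matPhi : Matrix.GeneralLinearGroup (Fin (a * b)) 𝔇.ring.R) :
          Matrix (Fin (a * b)) (Fin (a * b)) 𝔇.ring.R) =
        Matrix.reindex finProdFinEquiv finProdFinEquiv
          (Matrix.kroneckerMap (fun x y => x * y)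
            (((𝔇.Drig r₁).matPhi : Matrix.GeneralLinearGroup (Fin a) 𝔇.ring.R) : Matrix (Fin a) (Fin a) 𝔇.ring.R)
            (((𝔇.Drig r₂).matPhi : Matrix.GeneralLinearGroup (Fin b) 𝔇.ring.R) : Matrix (Fin b) (Fin b) 𝔇.ring.R)) ∧
      ∀ σ : Field.absoluteGaloisGroup F,
        ((((𝔇.Drig r).conj U).matGamma σ : Matrix.GeneralLinearGroup (Fin (a * b)) 𝔇.ring.R) :
            Matrix (Fin (a * b)) (Fin (a * b)) 𝔇.ring.R) =
          Matrix.reindex finProdFinEquiv finProdFinEquiv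
            (Matrix.kroneckerMap (fun x y => x * y)
              (((𝔇.Drig r₁).matGamma σ : Matrix.GeneralLinearGroup (Fin a) 𝔇.ring.R) : Matrix (Fin a) (Fin a) 𝔇.ring.R)
              (((𝔇.Drig r₂).matGamma σ : Matrix.GeneralLinearGroup (Fin b) 𝔇.ring.R) : Matrix (Fin b) (Fin b) 𝔇.ring.R))

/-- **Ding's perfect special pairing, in consumable form**: for a framed `(φ, Γ_F)`-module `D` (cyclotomic, continuous) with a
triangulation `T`, a consecutive ratio `δ_iδ_{i+1}⁻¹` which is special (`dim_E H²(𝓡(δ_iδ_{i+1}⁻¹)) = 1`) and a non-split graded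
class `c_i`, some continuous additive character `θ : Fˣ → E` has class (under `homToH1`, `H1toH1`) OUTSIDE `𝓛 = c_i^⊥` — because
the cup product `H¹(𝓡(δ)) × H¹(𝓡) → H²(𝓡(δ)) ≅ E` is perfect and `H¹(𝓡) ≅ Hom(Fˣ, E)`, so `c_i^⊥` is a hyperplane.  A predicate
ON the datum, nothing asserted.  [cite: Ding2019SimpleL, §3.1] -/
def PhiGammaModuleRobba.HasPerfectSpecialPairing (𝓣 : PhiGammaModuleRobba.{u, v, w} p F E) : Prop :=
  ∀ (m : ℕ) (D : FramedPhiGammaModule 𝓣.ring m) (T : D.toPhiGammaModule.Triangulation m) (i : ℕ) (hi : i + 1 < m),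
    𝓣.IsCyclotomic D → D.toPhiGammaModule.IsContinuous →
    Module.finrank E (𝓣.H2 (T.ratioParam i hi).toModule) = 1 → T.IsNonSplitAt 𝓣.gen i hi →
      ∃ θ : HomCont F E, 𝓣.H1toH1 (PhiGammaModule.unit 𝓣.ring) (𝓣.homToH1 θ) ∉
        (T.ratioParam i hi).toModule.cupOrthogonal 𝓣.gen (T.gradedClass 𝓣.gen i hi)

omit [IsTopologicalRing E] in
/-- **The gap derivative** of a pair of first-order characters `δ̃ᵢ, δ̃ⱼ : Fˣ → (E[ε])ˣ`: the function `x ↦ b/a` where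
`δ̃ᵢ(x) δ̃ⱼ(x)⁻¹ = a + bε`, i.e. the additive character `ψ` with `δ̃ᵢδ̃ⱼ⁻¹ = δᵢδⱼ⁻¹ (1 + εψ)` of the Colmez–Greenberg–Stevens
formula.  [cite: Ding2019SimpleL, Thm. 3.4] -/
def gapDerivative (δi δj : Fˣ →ₜ* (DualNumber E)ˣ) : Fˣ → E := fun x =>
  TrivSqZeroExt.snd (((δi x : (DualNumber E)ˣ) : DualNumber E) * (((δj x)⁻¹ : (DualNumber E)ˣ) : DualNumber E)) *
    (TrivSqZeroExt.fst (((δi x : (DualNumber E)ˣ) : DualNumber E) * (((δj x)⁻¹ : (DualNumber E)ˣ) : DualNumber E)))⁻¹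

/-- **The first-order Colmez–Greenberg–Stevens formula** (Ding's Thm. 3.4 at `A = E[ε]`), as a predicate on the relative
rank-one data `𝓒` of `𝓣`: let `D` be a framed `(φ, Γ_F)`-module (cyclotomic, continuous), upper-triangular with the rank-one data
`𝓡(δⱼ)` on the diagonal and NON-CRITICAL SPECIAL (every consecutive ratio special, every graded class non-split); let
`D̃ ∈ 𝓣.deformationsOver E[ε]` be a first-order deformation of `D` which is upper-triangular (in some basis `Ũ`) with the relative
rank-one data `𝓒.ofCharOver E[ε] (δ̃ⱼ)` on the diagonal, `δ̃ⱼ` lifting `δⱼ`; then for every `i` the gap derivative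
`ψᵢ = gapDerivative δ̃ᵢ δ̃ᵢ₊₁`, as an element of `Hom(Fˣ, E)`, has class in `𝓛(D)_i = c_i^⊥`.  Nothing asserted.
[cite: Ding2019SimpleL, Thm. 3.4] -/
def PhiGammaModuleRobba.RelativeCharData.HasColmezGreenbergStevens {𝓣 : PhiGammaModuleRobba.{u, v, w} p F E}
    (𝓒 : 𝓣.RelativeCharData) : Prop :=
  haveI : Module.Finite E (DualNumber E) := moduleFinite_dualNumber E
  ∀ (m : ℕ) (D : FramedPhiGammaModule 𝓣.ring m) (δ : Fin m → (Fˣ →ₜ* Eˣ))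
    (h : D.IsTriangularWith (fun j => ((𝓣.ofChar (δ j)).α : 𝓣.R)) (fun j σ => ((𝓣.ofChar (δ j)).c σ : 𝓣.R))),
    𝓣.IsCyclotomic D → D.toPhiGammaModule.IsContinuous →
    (∀ (i : ℕ) (hi : i + 1 < m),
      Module.finrank E (𝓣.H2 ((PhiGammaModule.Triangulation.ofTriangular D (fun j => 𝓣.ofChar (δ j)) h).ratioParam
        i hi).toModule) = 1 ∧
      (PhiGammaModule.Triangulation.ofTriangular D (fun j => 𝓣.ofChar (δ j)) h).IsNonSplitAt 𝓣.gen i hi) →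
    ∀ (Dε : FramedPhiGammaModule (𝓣.ring.baseChange (DualNumber E)) m),
      Dε ∈ 𝓣.deformationsOver (DualNumber E) (TrivSqZeroExt.fstHom E E E) D →
      ∀ (δε : Fin m → (Fˣ →ₜ* (DualNumber E)ˣ))
        (Uε : Matrix.GeneralLinearGroup (Fin m) (𝓣.ring.baseChange (DualNumber E)).R),
        (∀ (j : Fin m) (x : Fˣ), TrivSqZeroExt.fst ((δε j x : (DualNumber E)ˣ) : DualNumber E) = ((δ j x : Eˣ) : E)) →
        (Dε.conj Uε).IsTriangularWith
            (fun j => ((𝓒.ofCharOver (DualNumber E) (δε j)).α : (𝓣.ring.baseChange (DualNumber E)).R))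
            (fun j σ => ((𝓒.ofCharOver (DualNumber E) (δε j)).c σ : (𝓣.ring.baseChange (DualNumber E)).R)) →
        ∀ (i : ℕ) (hi : i + 1 < m) (ψ : HomCont F E),
          (∀ x : Fˣ, (ψ : Fˣ → E) x = gapDerivative (δε ⟨i, Nat.lt_of_succ_lt hi⟩) (δε ⟨i + 1, hi⟩) x) →
          𝓣.H1toH1 (PhiGammaModule.unit 𝓣.ring) (𝓣.homToH1 ψ) ∈
            ((PhiGammaModule.Triangulation.ofTriangular D (fun j => 𝓣.ofChar (δ j)) h).ratioParam i hi).toModule.cupOrthogonal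
              𝓣.gen ((PhiGammaModule.Triangulation.ofTriangular D (fun j => 𝓣.ofChar (δ j)) h).gradedClass 𝓣.gen i hi)


/-- The `𝓡`-component of an element of the first-order relative ring `𝓡_{E[ε]} = E[ε] ⊗_E 𝓡 = 𝓡 ⊕ ε𝓡`: `(fst ⊗ 1)`.
[folklore] -/
def PhiGammaRing.fstPart {Γ : Type u} [Group Γ] (𝓡 : PhiGammaRing.{u, v, w} Γ E)
    (z : (𝓡.baseChange (DualNumber E)).R) : 𝓡.R :=
  TensorProduct.lid E 𝓡.R (LinearMap.rTensor 𝓡.R (TrivSqZeroExt.fstHom E E E).toLinearMap z)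

/-- The `ε𝓡`-component of an element of `𝓡_{E[ε]} = 𝓡 ⊕ ε𝓡`: `(snd ⊗ 1)`. [folklore] -/
def PhiGammaRing.sndPart {Γ : Type u} [Group Γ] (𝓡 : PhiGammaRing.{u, v, w} Γ E)
    (z : (𝓡.baseChange (DualNumber E)).R) : 𝓡.R :=
  TensorProduct.lid E 𝓡.R (LinearMap.rTensor 𝓡.R (TrivSqZeroExt.sndHom E E) z)

/-- **Restriction of scalars of a matrix over `𝓡_{E[ε]}`** to `𝓡` in the basis `(e, εe)`: `P = P₀ + εP₁ ↦ [[P₀, 0], [P₁, P₀]]`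
(column convention, as `FramedPhiGammaModule.phiOp` acts by `*ᵥ`). [folklore] -/
def PhiGammaRing.resDualNumber {Γ : Type u} [Group Γ] (𝓡 : PhiGammaRing.{u, v, w} Γ E) {m : ℕ}
    (P : Matrix (Fin m) (Fin m) (𝓡.baseChange (DualNumber E)).R) : Matrix (Fin (m + m)) (Fin (m + m)) 𝓡.R :=
  Matrix.reindex finSumFinEquiv finSumFinEquiv
    (Matrix.fromBlocks (P.map 𝓡.fstPart) 0 (P.map 𝓡.sndPart) (P.map 𝓡.fstPart))

omit [TopologicalSpace E] [IsTopologicalRing E] in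
/-- **Restriction of scalars of a first-order matrix** `A + εB ∈ GL_m(E[ε])` to `GL_{2m}(E)` in the basis `(e, εe)`:
`[[A, 0], [B, A]]` (column convention, as `FramedRep.toContinuousRep` acts by `*ᵥ`). [folklore] -/
def resDualNumberMatrix {m : ℕ} (g : Matrix (Fin m) (Fin m) (DualNumber E)) : Matrix (Fin (m + m)) (Fin (m + m)) E :=
  Matrix.reindex finSumFinEquiv finSumFinEquiv
    (Matrix.fromBlocks (g.map TrivSqZeroExt.fst) 0 (g.map TrivSqZeroExt.snd) (g.map TrivSqZeroExt.fst))

/-- **`D_rig` over `E[ε]` is `D_rig` of the restriction of scalars** (first-order case of Bellaïche–Chenevier's DEFINITION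
`D_rig(V_A) := D_rig(Res_{A/ℚ_p} V_A)` with its `A`-action): if `ρ₂ : Γ_F →ₜ* GL_{2m}(E)` is the restriction of scalars of
`ρ_ε : Γ_F →ₜ* GL_m(E[ε])` in the basis `(e, εe)` (`resDualNumberMatrix`), then `D_rig(ρ₂)` is, in some basis, the restriction of
scalars of `DrigOver E[ε] ρ_ε` (`PhiGammaRing.resDualNumber` of its matrices).  This pins `DrigOver` on first-order deformations to
`Drig`: an automorphism of a deformation functor compatible with it preserves the isomorphism class of the underlying
`2m`-dimensional representation, hence lines in `Ext¹`, hence is a scalar when `End = E`.  A predicate ON the datum, nothing asserted.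
[cite: BellaicheChenevier2009, §2.2.1 and Lemma 2.2.7 (arXiv:math/0602340 numbering)] -/
def PhiGammaModuleRobba.DrigArtinian.HasRestrictionCompatibility {𝓣 : PhiGammaModuleRobba.{u, v, w} p F E}
    (𝓓 : 𝓣.DrigArtinian) : Prop :=
  ∀ (m : ℕ) (ρε : FramedGaloisRep F (DualNumber E) m) (ρ₂ : FramedGaloisRep F E (m + m)),
    (∀ σ : Field.absoluteGaloisGroup F,
      ((ρ₂ σ : Matrix.GeneralLinearGroup (Fin (m + m)) E) : Matrix (Fin (m + m)) (Fin (m + m)) E) =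
        resDualNumberMatrix ((ρε σ : Matrix.GeneralLinearGroup (Fin m) (DualNumber E)) : Matrix (Fin m) (Fin m) (DualNumber E))) →
    ∃ U : Matrix.GeneralLinearGroup (Fin (m + m)) 𝓣.R,
      ((((𝓣.Drig ρ₂).conj U).matPhi : Matrix.GeneralLinearGroup (Fin (m + m)) 𝓣.R) : Matrix (Fin (m + m)) (Fin (m + m)) 𝓣.R) =
        𝓣.ring.resDualNumber (((𝓓.drigOverDualNumber ρε).matPhi :
          Matrix.GeneralLinearGroup (Fin m) (𝓣.ring.baseChange (DualNumber E)).R) :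
            Matrix (Fin m) (Fin m) (𝓣.ring.baseChange (DualNumber E)).R) ∧
      ∀ σ : Field.absoluteGaloisGroup F,
        ((((𝓣.Drig ρ₂).conj U).matGamma σ : Matrix.GeneralLinearGroup (Fin (m + m)) 𝓣.R) :
            Matrix (Fin (m + m)) (Fin (m + m)) 𝓣.R) =
          𝓣.ring.resDualNumber (((𝓓.drigOverDualNumber ρε).matGamma σ :
            Matrix.GeneralLinearGroup (Fin m) (𝓣.ring.baseChange (DualNumber E)).R) :
              Matrix (Fin m) (Fin m) (𝓣.ring.baseChange (DualNumber E)).R)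

variable [Algebra ℚ_[p] E]

/-- **Ding's Steinberg dictionary** (§3.1 + Lemma 3.2 in the form the Steinberg mechanism consumes), `f` = the absolute inertia
degree of `F`: a framed `(φ, Γ_F)`-module `D` of rank `m ≥ 2` (cyclotomic, continuous; `m ≥ 2` is Ding's `Δ = {1, …, n-1} ≠ ∅` —
for `m = 0` the conclusion `N^{m-1} = 1 ≠ 0` fails on the zero space, see the module docstring) with a STRICT triangulation all of whose
consecutive ratios are special and all of whose graded classes are non-split, which is SEMISTABLE, and such that for every `i` NO
non-zero locally constant (= unramified) continuous additive character `ψ : Fˣ → E` has class in `𝓛(D)_i = c_i^⊥`, has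
`N^{m-1} ≠ 0` on Berger's `D_st(D)` ("`Hom_∞ ⊆ 𝓛(D)_i` iff `D_i^{i+1}` crystalline"; "`N^{n-1} ≠ 0` iff every `D_i^{i+1}` is
semistable non-crystalline").  A predicate ON the datum, nothing asserted.
[cite: Ding2019SimpleL, §3.1 and Lemma 3.2] -/
def PhiGammaModuleRobbaLog.HasDingSteinbergDictionary (𝓣 : PhiGammaModuleRobbaLog.{u, v, w} p F E) (f : ℕ) : Prop :=
  ∀ (m : ℕ), 2 ≤ m → ∀ (D : FramedPhiGammaModule 𝓣.ring m) (T : D.toPhiGammaModule.Triangulation m),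
    𝓣.IsCyclotomic D → D.toPhiGammaModule.IsContinuous →
    (∀ (i : ℕ) (hi : i + 1 < m), Module.finrank E (𝓣.H2 (T.ratioParam i hi).toModule) = 1) →
    (∀ (i : ℕ) (hi : i + 1 < m), T.IsNonSplitAt 𝓣.gen i hi) → T.IsStrict 𝓣.gen →
    𝓣.IsSemistable D.toPhiGammaModule f →
    (∀ (i : ℕ) (hi : i + 1 < m) (ψ : HomCont F E), IsLocallyConstant (ψ : Fˣ → E) → ψ ≠ 0 →
      𝓣.H1toH1 (PhiGammaModule.unit 𝓣.ring) (𝓣.homToH1 ψ) ∉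
        (T.ratioParam i hi).toModule.cupOrthogonal 𝓣.gen (T.gradedClass 𝓣.gen i hi)) →
    𝓣.nDst D.toPhiGammaModule ^ (m - 1) ≠ 0

/-- **The pinned Steinberg velocity package** of a `(φ, Γ_F)`-datum with log structure `𝓣`, `D_rig` over Artinian coefficients
`𝓐` and relative rank-one data `𝓒` (`d = [F:ℚ_p]`, `f` = inertia degree): KPX's theory (`IsKPX`), `⊗`-compatibility of `D_rig`
(the pin), functoriality of `D_rig` in Artinian coefficients with the Bellaïche–Chenevier equivalence and the restriction-of-scalars
compatibility over `E[ε]` (the second pin), compatibility of the relative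
rank-one objects, Ding's perfect special pairing, the first-order Colmez–Greenberg–Stevens formula and Ding's Steinberg dictionary.
Every conjunct is a printed theorem about the genuine objects; a route quantifies `∀ (𝓣, 𝓐, 𝓒), IsSteinbergVelocityPackage … → …`.
[cite: KedlayaPottharstXiao2014, Thm. 2.2.17], [cite: Ding2019SimpleL, §3.1, Lemma 3.2, Thm. 3.4],
[cite: BellaicheChenevier2009, Prop. 2.3.12 (arXiv:math/0602340 numbering)] -/
def PhiGammaModuleRobbaLog.IsSteinbergVelocityPackage (𝓣 : PhiGammaModuleRobbaLog.{u, v, w} p F E) (𝓐 : 𝓣.DrigArtinian)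
    (𝓒 : 𝓣.RelativeCharData) (d f : ℕ) : Prop :=
  𝓣.IsKPX d ∧ 𝓣.HasTensorCompatibleDrig ∧ 𝓐.IsFunctorial ∧ 𝓐.HasBCEquivalence ∧ 𝓐.HasRestrictionCompatibility ∧
    𝓒.IsCompatible ∧ 𝓣.HasPerfectSpecialPairing ∧ 𝓒.HasColmezGreenbergStevens ∧ 𝓣.HasDingSteinbergDictionary f

end Pins

/-! ## Part 2. Infinitesimal gap velocity of a global representation at a place above `p` -/

section Global

variable {K : Type} [Field K] [NumberField K] {p : ℕ} [Fact p.Prime]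
  {E₀ : Type} [Field E₀] [TopologicalSpace E₀] [IsTopologicalRing E₀] {n : ℕ}

/-- **Full infinitesimal gap velocity at the pair `(i, i+1)`** of the global framed representation `rK : Γ_K →ₜ* GL_n(E₀)` at
the place `v ∣ p`, relative to `(φ, Γ_{K_v})`-data `𝓣` with `D_rig` over Artinian coefficients `𝓐` and relative rank-one data
`𝓒`, and an `E₀`-valued parameter `δ`: every continuous additive `φ : K_vˣ → E₀` agrees ON THE UNITS `{v(x) = 1}` with an
`E₀`-linear combination `Σ_k c_k ψᵢ(δ̃_k)` of gap derivatives of GLOBAL first-order deformations `ρ̃_k : Γ_K →ₜ* GL_n(E₀[ε])` of `rK`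
(`fst ∘ ρ̃_k = rK` entrywise) whose `D_rig` at `v` (`𝓐.drigOverDualNumber (ρ̃_k|Γ_{K_v})`) is upper-triangular, in some basis
`Ũ_k`, with the relative rank-one data `𝓒.ofCharOver E₀[ε] (δ̃_{k,j})` on the diagonal, `δ̃_{k,j}` lifting `δ_j` — i.e. the gap
`(i, i+1)` of the trianguline parameter moves in all `[K_v:ℚ_p]` weight directions to first order along global tangent directions
("N is the derivative of the family"; the tangent space of the eigenvariety at a refined classical point is the intended source).
A DEFINITION (the crux of route SteinbergWeightVelocity is that it holds in the Steinberg situation), nothing asserted.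
[cite: HansenUniversalEigenvarieties2017, Thm. 1.1.6], [cite: Ding2019SimpleL, Thm. 3.4 and Prop. 3.6] -/
def FramedGaloisRep.HasInfinitesimalGapVelocityAt (v : HeightOneSpectrum (𝓞 K))
    {𝓣 : PhiGammaModuleRobba.{0, 0, 0} p (v.adicCompletion K) E₀} (𝓐 : 𝓣.DrigArtinian) (𝓒 : 𝓣.RelativeCharData)
    (rK : FramedGaloisRep K E₀ n) (δ : Fin n → ((v.adicCompletion K)ˣ →ₜ* E₀ˣ)) (i : ℕ) (hi : i + 1 < n) : Prop :=
  haveI : Module.Finite E₀ (DualNumber E₀) := moduleFinite_dualNumber E₀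
  ∀ φ : HomCont (v.adicCompletion K) E₀,
    ∃ (r : ℕ) (ρε : Fin r → FramedGaloisRep K (DualNumber E₀) n)
      (δε : Fin r → Fin n → ((v.adicCompletion K)ˣ →ₜ* (DualNumber E₀)ˣ))
      (Uε : Fin r → Matrix.GeneralLinearGroup (Fin n) (𝓣.ring.baseChange (DualNumber E₀)).R) (c : Fin r → E₀),
      (∀ (k : Fin r) (σ : Field.absoluteGaloisGroup K) (a b : Fin n),
        TrivSqZeroExt.fst (((ρε k) σ : Matrix.GeneralLinearGroup (Fin n) (DualNumber E₀)) a b) =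
          (rK σ : Matrix.GeneralLinearGroup (Fin n) E₀) a b) ∧
      (∀ (k : Fin r) (j : Fin n) (x : (v.adicCompletion K)ˣ),
        TrivSqZeroExt.fst ((δε k j x : (DualNumber E₀)ˣ) : DualNumber E₀) = ((δ j x : E₀ˣ) : E₀)) ∧
      (∀ k : Fin r, ((𝓐.drigOverDualNumber ((ρε k).toLocal v)).conj (Uε k)).IsTriangularWith
        (fun j => ((𝓒.ofCharOver (DualNumber E₀) (δε k j)).α : (𝓣.ring.baseChange (DualNumber E₀)).R))
        (fun j σ => ((𝓒.ofCharOver (DualNumber E₀) (δε k j)).c σ : (𝓣.ring.baseChange (DualNumber E₀)).R))) ∧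
      ∀ x : (v.adicCompletion K)ˣ, Valued.v (x : v.adicCompletion K) = 1 →
        (φ : (v.adicCompletion K)ˣ → E₀) x =
          ∑ k : Fin r, c k * gapDerivative (δε k ⟨i, Nat.lt_of_succ_lt hi⟩) (δε k ⟨i + 1, hi⟩) x

end Global

/-! ## Alias -/

/-- **Requested notion `SteinbergVelocityPackage`** (item `defn-SteinbergVelocityPackage`): the pinned package
`PhiGammaModuleRobbaLog.IsSteinbergVelocityPackage` under the requested name (alias for discoverability; see also
`FramedGaloisRep.HasInfinitesimalGapVelocityAt`). [cite: Ding2019SimpleL, §3.1, Lemma 3.2 and Thm. 3.4] -/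
abbrev SteinbergVelocityPackage {p : ℕ} [Fact p.Prime] {F : Type u} [Field F] [TopologicalSpace F]
    {E : Type v} [Field E] [TopologicalSpace E] [IsTopologicalRing E] [Algebra ℚ_[p] E]
    (𝓣 : PhiGammaModuleRobbaLog.{u, v, w} p F E) (𝓐 : 𝓣.DrigArtinian) (𝓒 : 𝓣.RelativeCharData) (d f : ℕ) : Prop :=
  𝓣.IsSteinbergVelocityPackage 𝓐 𝓒 d f


/-! ## Part 3. Proved API (second revision) -/

section API

open PhiGammaModule

/-! ### The gap derivative is an additive character; the defining identity -/

section GapDerivative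

variable {F : Type u} [Field F] [TopologicalSpace F] {E : Type v} [Field E] [TopologicalSpace E]

omit [TopologicalSpace E] in
/-- A unit of `E[ε]` has non-zero constant term. [folklore] -/
lemma fst_units_ne_zero (x : (DualNumber E)ˣ) : TrivSqZeroExt.fst (x : DualNumber E) ≠ 0 :=
  (TrivSqZeroExt.isUnit_iff_isUnit_fst.1 x.isUnit).ne_zero

/-- Unfolding lemma for `gapDerivative`: `ψ(z) = snd(x) · fst(x)⁻¹` for `x = δ̃ᵢ(z) δ̃ⱼ(z)⁻¹ ∈ E[ε]`. [folklore] -/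
lemma gapDerivative_apply (δi δj : Fˣ →ₜ* (DualNumber E)ˣ) (z : Fˣ) :
    gapDerivative δi δj z =
      TrivSqZeroExt.snd (((δi z : (DualNumber E)ˣ) : DualNumber E) * (((δj z)⁻¹ : (DualNumber E)ˣ) : DualNumber E)) *
        (TrivSqZeroExt.fst (((δi z : (DualNumber E)ˣ) : DualNumber E) *
          (((δj z)⁻¹ : (DualNumber E)ˣ) : DualNumber E)))⁻¹ := rfl

/-- The gap derivative of a character against itself vanishes (`δ̃δ̃⁻¹ = 1 = 1·(1 + ε·0)`). [folklore] -/
@[simp] lemma gapDerivative_self (δ : Fˣ →ₜ* (DualNumber E)ˣ) : gapDerivative δ δ = 0 := by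
  funext z
  rw [gapDerivative_apply, ← Units.val_mul, mul_inv_cancel, Units.val_one, TrivSqZeroExt.snd_one, zero_mul,
    Pi.zero_apply]

/-- **The defining identity** `δ̃ᵢ(z)δ̃ⱼ(z)⁻¹ = a · (1 + ε ψ(z))` with `a = fst(δ̃ᵢ(z)δ̃ⱼ(z)⁻¹)` (`= δᵢ(z)δⱼ(z)⁻¹` when
`δ̃ ≡ δ mod ε`) and `ψ = gapDerivative δ̃ᵢ δ̃ⱼ` — Ding's "`δ̃ᵢδ̃ᵢ₊₁⁻¹ = δᵢδᵢ₊₁⁻¹(1 + εψ)`". [cite: Ding2019SimpleL, Thm. 3.4] -/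
lemma ratio_eq_inl_fst_mul (δi δj : Fˣ →ₜ* (DualNumber E)ˣ) (z : Fˣ) :
    ((δi z : (DualNumber E)ˣ) : DualNumber E) * (((δj z)⁻¹ : (DualNumber E)ˣ) : DualNumber E) =
      TrivSqZeroExt.inl (TrivSqZeroExt.fst
          (((δi z : (DualNumber E)ˣ) : DualNumber E) * (((δj z)⁻¹ : (DualNumber E)ˣ) : DualNumber E))) *
        (1 + DualNumber.eps * TrivSqZeroExt.inl (gapDerivative δi δj z)) := by
  have ha : TrivSqZeroExt.fst
      (((δi z : (DualNumber E)ˣ) : DualNumber E) * (((δj z)⁻¹ : (DualNumber E)ˣ) : DualNumber E)) ≠ 0 := by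
    rw [← Units.val_mul]
    exact fst_units_ne_zero _
  refine TrivSqZeroExt.ext ?_ ?_
  · simp only [TrivSqZeroExt.fst_mul, TrivSqZeroExt.fst_inl, TrivSqZeroExt.fst_add,
      TrivSqZeroExt.fst_one, DualNumber.fst_eps, zero_mul, add_zero, mul_one]
  · simp only [gapDerivative_apply, DualNumber.snd_mul, TrivSqZeroExt.snd_inl, TrivSqZeroExt.fst_inl,
      TrivSqZeroExt.fst_add, TrivSqZeroExt.fst_one, TrivSqZeroExt.snd_add, TrivSqZeroExt.snd_one,
      TrivSqZeroExt.fst_mul, DualNumber.fst_eps, DualNumber.snd_eps, zero_mul, one_mul, zero_add,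
      add_zero, mul_zero] at ha ⊢
    rw [mul_left_comm, mul_inv_cancel₀ ha, mul_one]

/-- **The gap derivative is additive**: `ψ(zz') = ψ(z) + ψ(z')` (the ratio `x(z) = δ̃ᵢ(z)δ̃ⱼ(z)⁻¹` is multiplicative and
`snd(xy)/fst(xy) = snd(x)/fst(x) + snd(y)/fst(y)` for units of `E[ε]`); with continuity this is why `ψ` is an element of
`Hom(Fˣ, E)`. [folklore] -/
lemma gapDerivative_mul (δi δj : Fˣ →ₜ* (DualNumber E)ˣ) (z z' : Fˣ) :
    gapDerivative δi δj (z * z') = gapDerivative δi δj z + gapDerivative δi δj z' := by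
  have h1 : ((δi (z * z') : (DualNumber E)ˣ) : DualNumber E) =
      ((δi z : (DualNumber E)ˣ) : DualNumber E) * ((δi z' : (DualNumber E)ˣ) : DualNumber E) := by
    rw [map_mul, Units.val_mul]
  have h2 : (((δj (z * z'))⁻¹ : (DualNumber E)ˣ) : DualNumber E) =
      (((δj z')⁻¹ : (DualNumber E)ˣ) : DualNumber E) * (((δj z)⁻¹ : (DualNumber E)ˣ) : DualNumber E) := by
    rw [map_mul, mul_inv_rev, Units.val_mul]
  have ha := fst_units_ne_zero (δi z)
  have ha' := fst_units_ne_zero (δi z')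
  have hb := fst_units_ne_zero (δj z)⁻¹
  have hb' := fst_units_ne_zero (δj z')⁻¹
  simp only [gapDerivative_apply, h1, h2, DualNumber.snd_mul, TrivSqZeroExt.fst_mul]
  field_simp
  ring

end GapDerivative

/-! ### The `⊗`-pin in framed-tensor form; the perfect pairing; the package projections -/

section Pins

variable {p : ℕ} [Fact p.Prime] {F : Type u} [Field F] [TopologicalSpace F]
  {E : Type v} [Field E] [TopologicalSpace E] [IsTopologicalRing E]

/-- **The `⊗`-pin in framed-tensor form**: `HasTensorCompatibleDrig 𝔇` iff for all framed `ρ, ρ'`,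
`D_rig(ρ ⊗ ρ') ≅ D_rig(ρ) ⊗ D_rig(ρ')` with `FramedRep.tensor` / `FramedPhiGammaModule.tensor` of `DrigArtinianFunctor.lean`
(the Kronecker frames `glKronecker`, definitionally the matrices of the matrix form; a representation whose matrices are the
Kronecker products IS `ρ.tensor ρ'`).  This is the `E`-level case of `DrigArtinian.IsTensorial` (1).
[cite: KedlayaPottharstXiao2014, Thm. 2.2.17] -/
theorem PhiGammaModuleData.hasTensorCompatibleDrig_iff (𝔇 : PhiGammaModuleData.{u, v, w} p F E) :
    𝔇.HasTensorCompatibleDrig ↔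
      ∀ (a b : ℕ) (ρ : FramedGaloisRep F E a) (ρ' : FramedGaloisRep F E b),
        (𝔇.Drig (ρ.tensor ρ')).IsIso ((𝔇.Drig ρ).tensor (𝔇.Drig ρ')) := by
  constructor
  · intro h a b ρ ρ'
    obtain ⟨U, hP, hG⟩ := h a b ρ ρ' (ρ.tensor ρ') fun σ => rfl
    refine ⟨U, (FramedPhiGammaModule.ext (Units.ext hP) (funext fun σ => Units.ext (hG σ))).symm⟩
  · intro h a b ρ ρ' r hr
    have hr' : r = ρ.tensor ρ' := ContinuousMonoidHom.ext fun σ => Units.ext (hr σ)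
    subst hr'
    obtain ⟨U, hU⟩ := h a b ρ ρ'
    exact ⟨U, congrArg (fun D : FramedPhiGammaModule 𝔇.ring (a * b) =>
        ((D.matPhi : GL (Fin (a * b)) 𝔇.ring.R) : Matrix (Fin (a * b)) (Fin (a * b)) 𝔇.ring.R)) hU.symm,
      fun σ => congrArg (fun D : FramedPhiGammaModule 𝔇.ring (a * b) =>
        ((D.matGamma σ : GL (Fin (a * b)) 𝔇.ring.R) : Matrix (Fin (a * b)) (Fin (a * b)) 𝔇.ring.R)) hU.symm⟩

/-- Under the `⊗`-pin, `D_rig(ρ ⊗ ρ') ≅ D_rig(ρ) ⊗ D_rig(ρ')` (framed-tensor form). [cite: KedlayaPottharstXiao2014, Thm. 2.2.17] -/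
lemma PhiGammaModuleData.HasTensorCompatibleDrig.isIso_tensor {𝔇 : PhiGammaModuleData.{u, v, w} p F E}
    (h : 𝔇.HasTensorCompatibleDrig) {a b : ℕ} (ρ : FramedGaloisRep F E a) (ρ' : FramedGaloisRep F E b) :
    (𝔇.Drig (ρ.tensor ρ')).IsIso ((𝔇.Drig ρ).tensor (𝔇.Drig ρ')) :=
  (𝔇.hasTensorCompatibleDrig_iff.1 h) a b ρ ρ'

/-- Under the perfect pairing, `c_i^⊥` is a PROPER subspace of `H¹(𝓡)` at a special non-split pair (`𝓛(D)_i ≠ Hom(Fˣ, E)`).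
[cite: Ding2019SimpleL, §3.1] -/
lemma PhiGammaModuleRobba.HasPerfectSpecialPairing.cupOrthogonal_ne_top {𝓣 : PhiGammaModuleRobba.{u, v, w} p F E}
    (h : 𝓣.HasPerfectSpecialPairing) {m : ℕ} {D : FramedPhiGammaModule 𝓣.ring m}
    (T : D.toPhiGammaModule.Triangulation m) {i : ℕ} (hi : i + 1 < m) (hc : 𝓣.IsCyclotomic D)
    (hcont : D.toPhiGammaModule.IsContinuous) (hsp : Module.finrank E (𝓣.H2 (T.ratioParam i hi).toModule) = 1)
    (hns : T.IsNonSplitAt 𝓣.gen i hi) :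
    (T.ratioParam i hi).toModule.cupOrthogonal 𝓣.gen (T.gradedClass 𝓣.gen i hi) ≠ ⊤ := by
  obtain ⟨θ, hθ⟩ := h m D T i hi hc hcont hsp hns
  intro htop
  exact hθ (htop ▸ Submodule.mem_top)

variable [Algebra ℚ_[p] E]

namespace PhiGammaModuleRobbaLog.IsSteinbergVelocityPackage

variable {𝓣 : PhiGammaModuleRobbaLog.{u, v, w} p F E} {𝓐 : 𝓣.DrigArtinian} {𝓒 : 𝓣.RelativeCharData} {d f : ℕ}

/-- Projection: the KPX package. [folklore] -/
lemma isKPX (h : 𝓣.IsSteinbergVelocityPackage 𝓐 𝓒 d f) : 𝓣.IsKPX d := h.1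

/-- Projection: `⊗`-compatibility of `D_rig` (the pin). [folklore] -/
lemma hasTensorCompatibleDrig (h : 𝓣.IsSteinbergVelocityPackage 𝓐 𝓒 d f) : 𝓣.HasTensorCompatibleDrig := h.2.1

/-- Projection: functoriality of `D_rig` over finite local `E`-algebras. [folklore] -/
lemma isFunctorial (h : 𝓣.IsSteinbergVelocityPackage 𝓐 𝓒 d f) : 𝓐.IsFunctorial := h.2.2.1

/-- Projection: the Bellaïche–Chenevier deformation equivalence. [folklore] -/
lemma hasBCEquivalence (h : 𝓣.IsSteinbergVelocityPackage 𝓐 𝓒 d f) : 𝓐.HasBCEquivalence := h.2.2.2.1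

/-- Projection: restriction-of-scalars compatibility over `E[ε]` (the second pin). [folklore] -/
lemma hasRestrictionCompatibility (h : 𝓣.IsSteinbergVelocityPackage 𝓐 𝓒 d f) : 𝓐.HasRestrictionCompatibility :=
  h.2.2.2.2.1

/-- Projection: compatibility of the relative rank-one objects. [folklore] -/
lemma isCompatible (h : 𝓣.IsSteinbergVelocityPackage 𝓐 𝓒 d f) : 𝓒.IsCompatible := h.2.2.2.2.2.1

/-- Projection: Ding's perfect pairing at special ratios. [folklore] -/
lemma hasPerfectSpecialPairing (h : 𝓣.IsSteinbergVelocityPackage 𝓐 𝓒 d f) : 𝓣.HasPerfectSpecialPairing :=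
  h.2.2.2.2.2.2.1

/-- Projection: the first-order Colmez–Greenberg–Stevens formula. [folklore] -/
lemma hasColmezGreenbergStevens (h : 𝓣.IsSteinbergVelocityPackage 𝓐 𝓒 d f) : 𝓒.HasColmezGreenbergStevens :=
  h.2.2.2.2.2.2.2.1

/-- Projection: Ding's Steinberg dictionary. [folklore] -/
lemma hasDingSteinbergDictionary (h : 𝓣.IsSteinbergVelocityPackage 𝓐 𝓒 d f) : 𝓣.HasDingSteinbergDictionary f :=
  h.2.2.2.2.2.2.2.2

end PhiGammaModuleRobbaLog.IsSteinbergVelocityPackage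

end Pins

/-! ### First-order deformations: the entrywise condition is membership in `deformationsOver` -/

section Global

variable {K : Type} [Field K] {n : ℕ} {E₀ : Type} [Field E₀] [TopologicalSpace E₀] [IsTopologicalRing E₀]

/-- The first-order deformations entering `HasInfinitesimalGapVelocityAt` (`fst ∘ ρ̃ = rK` entrywise) are exactly the members
of `FramedGaloisRep.deformationsOver (DualNumber E₀) fstHom rK` (reduction modulo `ε` EQUAL to `rK`), to which
`DrigArtinian.IsFunctorial.drigOver_mem_deformationsOver` and `HasBCEquivalence` apply. [folklore] -/
lemma FramedGaloisRep.fst_apply_eq_iff_mem_deformationsOver (rK : FramedGaloisRep K E₀ n)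
    (ρε : FramedGaloisRep K (DualNumber E₀) n) :
    (∀ (σ : Field.absoluteGaloisGroup K) (a b : Fin n),
        TrivSqZeroExt.fst ((ρε σ : Matrix.GeneralLinearGroup (Fin n) (DualNumber E₀)) a b) =
          (rK σ : Matrix.GeneralLinearGroup (Fin n) E₀) a b) ↔
      haveI := isModuleTopology_dualNumber E₀
      ρε ∈ FramedGaloisRep.deformationsOver (DualNumber E₀) (TrivSqZeroExt.fstHom E₀ E₀ E₀) rK :=
  (FramedGaloisRep.mem_deformationsOver_dualNumber_iff rK ρε).symm

end Global

end API

end Literature.NumberTheory.GaloisRepresentations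

end
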